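import Summits.BirchSwinnertonDyer.BirchSwinnertonDyer.Theorems.QuadraticBranchSignedControlPlusKatoDivisibilityBranchOntoOfNamedFactsContra
import Summits.BirchSwinnertonDyer.BirchSwinnertonDyer.Theorems.ThetaPartnerAtTwoSignedKatoUpToAtTwoOffTwoRoad
import HarnessLib

/-!
# K8 crux 20445 `PlusKatoDivisibilityBranchOnto`: the ι-SAFE SLICE from `{hZ, Q73′, h12}` — at every height-one prime
# FIXED by the Iwasawa involution the K8 chain runs over the PRINT-EXACT Kato 13.4 (Q73′) with no further input

Cell `bsd-potss` (HOME `run/shared/lean/pub/bsd-potss/`), seat `bsd-potss-k8q-c2x` g9 (prover; lane B of the K8 Kato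
side, route `QuadraticBranchSignedControl`), duty T-Q73ι-1, part 2 of 2 (part 1 = `…BranchOntoOfNamedFactsContra`:
Q73′ ⟺ tree-dual-at-`ι𝔭`, and the exact price of the literal re-keying). HONEST FRAMING: THEOREMS ONLY — no
definition, no named fact, no instance, no `sorry`; closes no item; the named-fact inputs are displayed hypotheses
(`hZ` = `Kobayashi2003.thm62_63_73_etaColemanPoitouTate_zeta`, `h134c` = Q73′ =
`Kato2004.thm13_4_lengthAt_fineSelmerDualContra_le_of_isEulerSystemClass`, `h12` =
`Kobayashi2003.thm12_signedSelmerDual_finite_torsion`); BSD is not proved by any of this; nothing is booked.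

## What is proved

With `hZ` AS TYPED (Kobayashi's (7.21) with a `Λ`-LINEAR Poitou–Tate map `j : Λ → X(D)`, `D`, `FB` over `γ`) and the
print-exact Q73′ read on the tree dual (`ℓ_𝔭(X₀) ≤ ℓ_{ι𝔭}(𝐇¹/Λz)`, part 1 §1), Kobayashi's four-term road
`ℓ_𝔭(X(D)) + ℓ_𝔭(𝐇¹/Λz) ≤ ℓ_𝔭(X₀) + ℓ_𝔭(Λ/(Col⁺ z))` (`SignedKatoOffTwo.fourTerm_lengthAt_le`, bsd-wall cell)
closes at every height-one prime `𝔭` with `ι𝔭 = 𝔭` — this includes `(T)`, `(p)` and the cyclotomic primes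
`(Φ_{pⁿ}(1+T))`, i.e. every prime at which orders of vanishing at finite-order characters of `Γ` are read:
* §1 `lengthAt_etaSigned_le_of_lengthAt_fine_le` (core), `lengthAt_etaSigned_le_of_zeta_of_thm13_4Contra` (clause (2):
  `ι`-fixed `𝔭 ∌ p`), `…_of_irreducible` (clause (3): every `ι`-fixed `𝔭`): `ℓ_𝔭(X(D)) ≤ ℓ_𝔭(Λ/(Col⁺ z))` for one
  `η`-datum `D` on a genuine frame.
* §2 `etaKatoFixedPrimes_of_zeta_of_thm13_4Contra` (Kobayashi Thm. 2.2 (`+`) at `η` and the `ι`-safe part of Thm. 4.1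
  for ONE curve), and BY NAME on the crux's tower-onto rows
  `plusKatoDivisibilityBranchOntoFixedPrimes_of_zeta_of_thm13_4Contra_of_thm12` (the row binders of the crux, then
  the binders of `QuadraticBranchPlusKatoDivisibilityAt V p` verbatim):
  `X⁺(V'/F_∞)` finitely generated torsion and
  `ℓ_𝔭(X⁺(V'/F_∞)) ≤ ℓ_𝔭(X⁺(V/ℚ_∞)) + ℓ_𝔭(Λ/(L_p⁺(V,η,X)))` at every `ι`-fixed height-one `𝔭`.
At a general `𝔭` the same chain gives the `L`-side at `ι𝔭`, and the literal crux needs part 1 §2's `ι`-symmetry or a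
print-exact (ι-semilinear) reading of `hZ` — not claimed here.

References: [Kobayashi2003] Thm. 1.2, 2.2, 4.1, 6.3, 7.3, proof of Thm. 7.4 (pp. 2–13); [Kato2004Asterisque] Thm. 13.4
(p. 226), (12.5.2) (p. 222), §17.13 (p. 280); [GreenbergLNM1716] §1 p. 60, §3.
-/

noncomputable section

-- justification: the `Summit.BirchSwinnertonDyer.BirchSwinnertonDyer.…` path repeats a component (route-file convention)
set_option linter.dupNamespace false
set_option autoImplicit false

open scoped Classical

open CongruenceSubgroup Field WeierstrassCurve
open Literature.NumberTheory.EllipticCurves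
open Literature.NumberTheory.EllipticCurves.ModularForms
open Literature.NumberTheory.EllipticCurves.Module
open Literature.NumberTheory.GaloisRepresentations
open Summit.BirchSwinnertonDyer.Rank1Residual.Additive hiding EtaSignedSelmerDualData
open Summit.BirchSwinnertonDyer.Rank1Residual.Additive.SignedTwist
open Summit.BirchSwinnertonDyer.BirchSwinnertonDyer.Theses.QuadraticBranchSignedControl

namespace Summit.BirchSwinnertonDyer.BirchSwinnertonDyer.Theorems

namespace KatoSideContra

open SignedKatoOffTwo.IwasawaInvolution

/-! ## §1 The four-term road at ONE prime, and the Kato step at the `ι`-fixed primes -/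

section Row

variable {p : ℕ} [Fact p.Prime] {K₀ : Type} [Field K₀] [NumberField K₀]
  [(galRange (K := ℚ) K₀).Normal] {η : absoluteGaloisGroup ℚ →* ℤˣ}
  {V : WeierstrassCurve ℚ} [V.IsElliptic] [V.IsGloballyMinimal] {N : ℕ} [NeZero N]
  {f : CuspForm (Gamma0 N) 2} {ϖ : ℚ} {κ : ZpExtension ℚ p} {γ : absoluteGaloisGroup ℚ}
  {W : WeierstrassCurve ℚ} [W.IsElliptic] [ContinuousSMul ℤ_[p] (W.tateModule p)]
  [Module.Free ℤ_[p] (W.tateModule p)] [Module.Finite ℤ_[p] (W.tateModule p)]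
  {I : Kato2004.IwasawaH1Data W p κ γ} {FB : W.FineSelmerDualData κ γ}

/-- `Col⁺(z) ≠ 0` on a genuine frame: `Col⁺(z) = L_p⁺(V, η, X) ≠ 0` (Rohrlich; periods positive); copy of the
private lemma of `…BranchOntoOfFacts`. [cite: Kobayashi2003, Thm. 6.3 (p. 11) and Thm. 7.3 i) (p. 13)] -/
theorem colPlus_z_ne_zero (E : Kobayashi2003.EtaColemanPoitouTateZetaData p K₀ η V f ϖ κ γ W I FB)
    (hp2 : p ≠ 2) (hgood : V.HasGoodReductionAtPrime p) (hf : IsNewformOf V f)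
    (hϖ : if Even (p / 2) then (ϖ : ℝ) * V.realPeriodRat = plusPeriod f
      else (ϖ : ℝ) * V.imaginaryPeriodRat = minusPeriod f) : E.colPlus E.z ≠ 0 := by
  have hϖ0 : ϖ ≠ 0 := by
    rintro rfl
    rw [Rat.cast_zero, zero_mul, zero_mul] at hϖ
    by_cases h2 : Even (p / 2)
    · rw [if_pos h2] at hϖ
      exact (IsNewform0.plusPeriod_pos_holds hf.1 hf.coeffField_eq_bot).ne hϖ
    · rw [if_neg h2] at hϖ
      exact (IsNewform0.minusPeriod_pos_holds hf.1 hf.coeffField_eq_bot).ne hϖ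
  exact IsQuadraticBranchPlusLFunction.ne_zero_of_isNewformOf hp2 hf hgood hϖ0 E.isPlus_colPlus_z

omit [V.IsGloballyMinimal] [NeZero N] in
/-- `𝐇¹_Γ(T_pW)/Λz` is killed by `Col⁺(z)` (`Col⁺` injective and `Λ`-linear). [cite: Kobayashi2003, Thm. 7.3 i) (p. 13)] -/
theorem isTorsionBy_quotient_colPlus_z (E : Kobayashi2003.EtaColemanPoitouTateZetaData p K₀ η V f ϖ κ γ W I FB) :
    Module.IsTorsionBy (IwasawaAlgebra p) (I.H ⧸ Submodule.span (IwasawaAlgebra p) {E.z}) (E.colPlus E.z) := by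
  intro x
  induction x using Submodule.Quotient.induction_on with
  | H m =>
    rw [← Submodule.Quotient.mk_smul, Submodule.Quotient.mk_eq_zero, Submodule.mem_span_singleton]
    refine ⟨E.colPlus m, E.colPlus_injective ?_⟩
    rw [map_smul, map_smul, smul_eq_mul, smul_eq_mul, mul_comm]

/-- **The ι-safe Kato step for ONE `η`-datum, core form.** On a genuine frame `E` (hZ's structure) with Kobayashi's
(7.21) `𝐇¹ →Col⁺ Λ → X(D) → X₀ → 0`, at ANY prime `𝔭` of height `≤ 1` where the Kato inequality
`ℓ_𝔭(X₀) ≤ ℓ_𝔭(𝐇¹/Λz)` is available: `ℓ_𝔭(X(D)) ≤ ℓ_𝔭(Λ/(Col⁺ z))` (the four-term road of the proof of Thm. 7.4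
read prime by prime; `ℓ_𝔭(𝐇¹/Λz) < ⊤` because `Col⁺ z ≠ 0` kills it).
[cite: Kobayashi2003, proof of Thm. 7.4 and last sentence of §7 (p. 13)] [cite: Kato2004Asterisque, §17.13 (p. 280)] -/
theorem lengthAt_etaSigned_le_of_lengthAt_fine_le
    (E : Kobayashi2003.EtaColemanPoitouTateZetaData p K₀ η V f ϖ κ γ W I FB)
    (hp2 : p ≠ 2) (hgood : V.HasGoodReductionAtPrime p) (hf : IsNewformOf V f)
    (hϖ : if Even (p / 2) then (ϖ : ℝ) * V.realPeriodRat = plusPeriod f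
      else (ϖ : ℝ) * V.imaginaryPeriodRat = minusPeriod f)
    (hκ : κ.IsCyclotomic) (hγ : κ.IsTopGenerator γ)
    (D : Kobayashi2003.EtaSignedSelmerDualData V κ K₀ ℚ_[p] η γ 1)
    (𝔭 : PrimeSpectrum (IwasawaAlgebra p)) (h𝔭 : 𝔭.asIdeal.height ≤ 1)
    (hK : lengthAt (IwasawaAlgebra p) FB.X 𝔭 ≤
      lengthAt (IwasawaAlgebra p) (I.H ⧸ Submodule.span (IwasawaAlgebra p) {E.z}) 𝔭) :
    lengthAt (IwasawaAlgebra p) D.X 𝔭 ≤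
      lengthAt (IwasawaAlgebra p) (IwasawaAlgebra p ⧸ Ideal.span {E.colPlus E.z}) 𝔭 := by
  haveI : Module.Finite (IwasawaAlgebra p) I.H := Kato2004.IwasawaH1Data.module_finite_of_isCyclotomic hκ hγ I
  have hL0 := colPlus_z_ne_zero E hp2 hgood hf hϖ
  obtain ⟨j, k, hcj, hjk, -⟩ := E.exact_plus D
  have h4 := SignedKatoOffTwo.fourTerm_lengthAt_le (LinearMap.id : IwasawaAlgebra p →ₗ[IwasawaAlgebra p] _)
    (fun _ _ h ↦ h) E.colPlus E.colPlus_injective j k hcj hjk E.z 𝔭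
  have hfin : lengthAt (IwasawaAlgebra p) (I.H ⧸ Submodule.span (IwasawaAlgebra p) {E.z}) 𝔭 ≠ ⊤ :=
    Module.lengthAt_ne_top_of_isTorsionBy hL0 (isTorsionBy_quotient_colPlus_z E) 𝔭 h𝔭
  have h : lengthAt (IwasawaAlgebra p) D.X 𝔭 +
        lengthAt (IwasawaAlgebra p) (I.H ⧸ Submodule.span (IwasawaAlgebra p) {E.z}) 𝔭 ≤
      lengthAt (IwasawaAlgebra p) (IwasawaAlgebra p ⧸ Ideal.span {E.colPlus E.z}) 𝔭 +
        lengthAt (IwasawaAlgebra p) (I.H ⧸ Submodule.span (IwasawaAlgebra p) {E.z}) 𝔭 :=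
    h4.trans ((add_le_add hK le_rfl).trans (le_of_eq (add_comm _ _)))
  exact (WithTop.add_le_add_iff_right hfin).mp h

/-- **The ι-safe Kato step for ONE `η`-datum from `{hZ's frame, Q73′}`, clause (2): at every `ι`-FIXED height-one
prime `𝔭 ∌ p`, `ℓ_𝔭(X(D)) ≤ ℓ_𝔭(Λ/(Col⁺ z))`** — Q73′ read on the tree dual gives `ℓ_𝔭(X₀) ≤ ℓ_{ι𝔭}(𝐇¹/Λz)`
(§1), and `ι𝔭 = 𝔭`. No `ι`-symmetry hypothesis. The `ι`-fixed height-one primes include `(T)` and the cyclotomic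
primes `(Φ_{pⁿ}(1+T))`. [cite: Kato2004Asterisque, Thm. 13.4 (2) (p. 226)] [cite: Kobayashi2003, proof of Thm. 7.4 (p. 13)] -/
theorem lengthAt_etaSigned_le_of_zeta_of_thm13_4Contra
    (E : Kobayashi2003.EtaColemanPoitouTateZetaData p K₀ η V f ϖ κ γ W I FB)
    (h134c : Kato2004.thm13_4_lengthAt_fineSelmerDualContra_le_of_isEulerSystemClass)
    (hp2 : p ≠ 2) (hgood : V.HasGoodReductionAtPrime p) (hf : IsNewformOf V f)
    (hϖ : if Even (p / 2) then (ϖ : ℝ) * V.realPeriodRat = plusPeriod f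
      else (ϖ : ℝ) * V.imaginaryPeriodRat = minusPeriod f)
    (hκ : κ.IsCyclotomic) (hγ : κ.IsTopGenerator γ)
    (hv : ∃ σ : absoluteGaloisGroup ℚ,
      (∀ (n : ℕ) (t : AlgebraicClosure ℚ), t ^ p ^ n = 1 → σ • t = t) ∧
        Module.finrank ℤ_[p] ((W.tateModule p) ⧸ LinearMap.range (W.galoisRepTate p σ - 1)) = 1)
    (D : Kobayashi2003.EtaSignedSelmerDualData V κ K₀ ℚ_[p] η γ 1)
    (𝔭 : PrimeSpectrum (IwasawaAlgebra p)) (h𝔭 : 𝔭.asIdeal.height = 1)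
    (hfix : PrimeSpectrum.comap (IwasawaAlgebra.invol p).toRingHom 𝔭 = 𝔭)
    (hp𝔭 : PowerSeries.C (p : ℤ_[p]) ∉ 𝔭.asIdeal) :
    lengthAt (IwasawaAlgebra p) D.X 𝔭 ≤
      lengthAt (IwasawaAlgebra p) (IwasawaAlgebra p ⧸ Ideal.span {E.colPlus E.z}) 𝔭 := by
  have hL0 := colPlus_z_ne_zero E hp2 hgood hf hϖ
  have hz0 : E.z ≠ 0 := fun hz ↦ hL0 (by rw [hz, map_zero])
  have hK := (katoBoundInv_of_contra h134c hp2 hκ hγ I FB E.z E.isEulerSystemClass_z hz0 hv).1 𝔭 h𝔭 hp𝔭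
  rw [hfix] at hK
  exact lengthAt_etaSigned_le_of_lengthAt_fine_le E hp2 hgood hf hϖ hκ hγ D 𝔭 (le_of_eq h𝔭) hK

/-- **The same under clause (3)** (`W[p]` irreducible and a free rank-one `Coker(ρ σ − 1)`): at EVERY `ι`-fixed
height-one prime `𝔭` (now including `(p)`), `ℓ_𝔭(X(D)) ≤ ℓ_𝔭(Λ/(Col⁺ z))`.
[cite: Kato2004Asterisque, Thm. 13.4 (3) (p. 226)] [cite: Kobayashi2003, proof of Thm. 7.4 (p. 13)] -/
theorem lengthAt_etaSigned_le_of_zeta_of_thm13_4Contra_of_irreducible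
    (E : Kobayashi2003.EtaColemanPoitouTateZetaData p K₀ η V f ϖ κ γ W I FB)
    (h134c : Kato2004.thm13_4_lengthAt_fineSelmerDualContra_le_of_isEulerSystemClass)
    (hp2 : p ≠ 2) (hgood : V.HasGoodReductionAtPrime p) (hf : IsNewformOf V f)
    (hϖ : if Even (p / 2) then (ϖ : ℝ) * V.realPeriodRat = plusPeriod f
      else (ϖ : ℝ) * V.imaginaryPeriodRat = minusPeriod f)
    (hκ : κ.IsCyclotomic) (hγ : κ.IsTopGenerator γ)
    (hv : ∃ σ : absoluteGaloisGroup ℚ,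
      (∀ (n : ℕ) (t : AlgebraicClosure ℚ), t ^ p ^ n = 1 → σ • t = t) ∧
        Module.finrank ℤ_[p] ((W.tateModule p) ⧸ LinearMap.range (W.galoisRepTate p σ - 1)) = 1)
    (hirr : W.HasIrreducibleModPGaloisRep p)
    (h3W : ∃ σ : absoluteGaloisGroup ℚ,
      (∀ (n : ℕ) (t : AlgebraicClosure ℚ), t ^ p ^ n = 1 → σ • t = t) ∧
        Nonempty (((W.tateModule p) ⧸ LinearMap.range (W.galoisRepTate p σ - 1)) ≃ₗ[ℤ_[p]] ℤ_[p]))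
    (D : Kobayashi2003.EtaSignedSelmerDualData V κ K₀ ℚ_[p] η γ 1)
    (𝔭 : PrimeSpectrum (IwasawaAlgebra p)) (h𝔭 : 𝔭.asIdeal.height = 1)
    (hfix : PrimeSpectrum.comap (IwasawaAlgebra.invol p).toRingHom 𝔭 = 𝔭) :
    lengthAt (IwasawaAlgebra p) D.X 𝔭 ≤
      lengthAt (IwasawaAlgebra p) (IwasawaAlgebra p ⧸ Ideal.span {E.colPlus E.z}) 𝔭 := by
  have hL0 := colPlus_z_ne_zero E hp2 hgood hf hϖ
  have hz0 : E.z ≠ 0 := fun hz ↦ hL0 (by rw [hz, map_zero])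
  have hK := (katoBoundInv_of_contra h134c hp2 hκ hγ I FB E.z E.isEulerSystemClass_z hz0 hv).2 hirr h3W 𝔭 h𝔭
  rw [hfix] at hK
  exact lengthAt_etaSigned_le_of_lengthAt_fine_le E hp2 hgood hf hϖ hκ hγ D 𝔭 (le_of_eq h𝔭) hK

end Row

/-! ## §2 One curve at `η`, and the crux's rows BY NAME -/

section RK

variable {p : ℕ} [Fact p.Prime]

/-- **Kobayashi Thm. 2.2 (`+`) at the quadratic `η` and the ι-SAFE part of Thm. 4.1 for ONE curve from
`{hZ, Q73′}`** under Kato's (v) for `V^{(p*)}`: `X⁺(V/K_∞)^η` is finitely generated torsion (from (7.21), `Col⁺ z ≠ 0`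
and Cor. 7.2 — no Kato), and at every `ι`-FIXED height-one prime (`𝔭 ∌ p`; every such `𝔭` when `ρ̄_{V,p^m}` is onto
for all `m`, via (12.5.2) for the twist) `ℓ_𝔭(X⁺(V/K_∞)^η) ≤ ℓ_𝔭(Λ/(L_p⁺(V,η,X)))`. The full-prime version
(`L_p⁺ ∈ char`) is `…BranchOntoOfFacts`'s private `etaKatoDivisibility_of_zeta_of_thm13_4` over Q73; over Q73′ only
the `ι`-fixed primes survive without an `ι`-symmetry (§2).
[cite: Kobayashi2003, Thm. 2.2 (p. 5), Thm. 4.1 (p. 8), proof of Thm. 7.4 (p. 13)] [cite: Kato2004Asterisque, Thm. 13.4 (p. 226), (12.5.2) (p. 222)] -/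
theorem etaKatoFixedPrimes_of_zeta_of_thm13_4Contra
    (hZ : Kobayashi2003.thm62_63_73_etaColemanPoitouTate_zeta)
    (h134c : Kato2004.thm13_4_lengthAt_fineSelmerDualContra_le_of_isEulerSystemClass)
    (K₀ : Type) [Field K₀] [NumberField K₀] [IsCyclotomicExtension {p} ℚ K₀]
    [(galRange (K := ℚ) K₀).Normal] (ηq : absoluteGaloisGroup ℚ →* ℤˣ)
    (hηK : ∀ σ ∈ galRange (K := ℚ) K₀, ηq σ = 1) (hη1 : ηq ≠ 1)
    (V : WeierstrassCurve ℚ) [V.IsElliptic] [V.IsGloballyMinimal]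
    (hv : ∀ [(V.quadraticTwist (((-1 : ℚ) ^ (p / 2)) * p)).IsElliptic],
      ∃ σ : absoluteGaloisGroup ℚ,
        (∀ (n : ℕ) (t : AlgebraicClosure ℚ), t ^ p ^ n = 1 → σ • t = t) ∧
          Module.finrank ℤ_[p]
            (((V.quadraticTwist (((-1 : ℚ) ^ (p / 2)) * p)).tateModule p) ⧸
              LinearMap.range
                ((V.quadraticTwist (((-1 : ℚ) ^ (p / 2)) * p)).galoisRepTate p σ - 1)) = 1)
    {N : ℕ} [NeZero N] {f : CuspForm (Gamma0 N) 2} (hp2 : p ≠ 2)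
    (hgood : V.HasGoodReductionAtPrime p) (hap : V.frobeniusTrace p = 0) (hf : IsNewformOf V f)
    (ϖ : ℚ) (hϖ : if Even (p / 2) then (ϖ : ℝ) * V.realPeriodRat = plusPeriod f
      else (ϖ : ℝ) * V.imaginaryPeriodRat = minusPeriod f)
    (Lη : IwasawaAlgebra p) (hL : IsQuadraticBranchPlusLFunction f p ϖ Lη)
    (κ : ZpExtension ℚ p) (γ : absoluteGaloisGroup ℚ) (hκ : κ.IsCyclotomic) (hγ : κ.IsTopGenerator γ)
    (hγK : γ ∈ galRange (K := ℚ) K₀) (hγc : IsCyclotomicVariable p γ)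
    (D : Kobayashi2003.EtaSignedSelmerDualData V κ K₀ ℚ_[p] ηq γ 1) :
    Module.Finite (IwasawaAlgebra p) D.X ∧ Module.IsTorsion (IwasawaAlgebra p) D.X ∧
      (∀ 𝔭 : PrimeSpectrum (IwasawaAlgebra p), 𝔭.asIdeal.height = 1 →
        PrimeSpectrum.comap (IwasawaAlgebra.invol p).toRingHom 𝔭 = 𝔭 →
        PowerSeries.C (p : ℤ_[p]) ∉ 𝔭.asIdeal →
          lengthAt (IwasawaAlgebra p) D.X 𝔭 ≤
            lengthAt (IwasawaAlgebra p) (IwasawaAlgebra p ⧸ Ideal.span {Lη}) 𝔭) ∧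
      ((∀ m : ℕ, V.HasSurjectiveModNGaloisRep (p ^ m : ℕ)) →
        ∀ 𝔭 : PrimeSpectrum (IwasawaAlgebra p), 𝔭.asIdeal.height = 1 →
          PrimeSpectrum.comap (IwasawaAlgebra.invol p).toRingHom 𝔭 = 𝔭 →
            lengthAt (IwasawaAlgebra p) D.X 𝔭 ≤
              lengthAt (IwasawaAlgebra p) (IwasawaAlgebra p ⧸ Ideal.span {Lη}) 𝔭) := by
  have hp : p.Prime := Fact.out
  have hc : (((-1 : ℚ) ^ (p / 2)) * p) ≠ 0 :=
    mul_ne_zero (pow_ne_zero _ (by norm_num)) (Nat.cast_ne_zero.mpr hp.ne_zero)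
  haveI : (V.quadraticTwist (((-1 : ℚ) ^ (p / 2)) * p)).IsElliptic := V.isElliptic_quadraticTwist hc
  haveI : ContinuousSMul ℤ_[p] ((V.quadraticTwist (((-1 : ℚ) ^ (p / 2)) * p)).tateModule p) :=
    TateModule.continuousSMul_padicInt
  haveI : Module.Free ℤ_[p] ((V.quadraticTwist (((-1 : ℚ) ^ (p / 2)) * p)).tateModule p) :=
    (V.quadraticTwist (((-1 : ℚ) ^ (p / 2)) * p)).module_free_tateModule_holds p
  haveI : Module.Finite ℤ_[p] ((V.quadraticTwist (((-1 : ℚ) ^ (p / 2)) * p)).tateModule p) :=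
    (V.quadraticTwist (((-1 : ℚ) ^ (p / 2)) * p)).module_finite_tateModule_holds p
  obtain ⟨C, hC⟩ := exists_variableChange_twist_twist V hc
  obtain ⟨I⟩ := Kato2004.nonempty_iwasawaH1Data_holds (V.quadraticTwist (((-1 : ℚ) ^ (p / 2)) * p))
    p κ γ hκ hγ
  obtain ⟨FB⟩ := (V.quadraticTwist (((-1 : ℚ) ^ (p / 2)) * p)).nonempty_fineSelmerDualData κ hγ
  haveI : Module.Finite (IwasawaAlgebra p) FB.X :=
    WeierstrassCurve.FineSelmerDualData.module_finite _ κ hγ FB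
  obtain ⟨E⟩ := hZ p K₀ ηq hηK hη1 V hp2 hgood hap hf ϖ hϖ κ γ hκ hγ hγK hγc
    (V.quadraticTwist (((-1 : ℚ) ^ (p / 2)) * p)) C hC I FB
  have hL0 : E.colPlus E.z ≠ 0 := colPlus_z_ne_zero E hp2 hgood hf hϖ
  have hspan : Ideal.span ({Lη} : Set (IwasawaAlgebra p)) = Ideal.span {E.colPlus E.z} :=
    IsQuadraticBranchPlusLFunction.span_singleton_eq hp2 hL E.isPlus_colPlus_z
  -- finiteness and torsion of `X(D)` from (7.21) mod `z` (no Kato input)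
  obtain ⟨j, k, hcj, hjk, hk⟩ := E.exact_plus D
  obtain ⟨i, j', k', hi, hij, hjk', hk'⟩ :=
    Thm74Skeleton.exists_fourTermExact_of_threeTermExact E.colPlus j k E.colPlus_injective hcj hjk hk
      E.z
  refine ⟨Module.Finite.of_exact hjk hk,
    Thm74Skeleton.isTorsion_of_exact (Thm74Skeleton.isTorsion_quotient_span_singleton hL0)
      E.isTorsion_fine j' k' hjk', fun 𝔭 h𝔭 hfix hp𝔭 ↦ ?_, fun hsurj 𝔭 h𝔭 hfix ↦ ?_⟩
  · rw [hspan]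
    exact lengthAt_etaSigned_le_of_zeta_of_thm13_4Contra E h134c hp2 hgood hf hϖ hκ hγ hv D 𝔭 h𝔭 hfix hp𝔭
  · haveI : NeZero ((p : ℕ) : ℚ) := ⟨Nat.cast_ne_zero.mpr hp.ne_zero⟩
    have hirrV : V.HasIrreducibleModPGaloisRep p :=
      hasIrreducibleModPGaloisRep_of_hasSurjectiveModNGaloisRep V p (by simpa using hsurj 1)
    have hirrW : (V.quadraticTwist (((-1 : ℚ) ^ (p / 2)) * p)).HasIrreducibleModPGaloisRep p := by
      have h1 := Mazur1978.hasIrreducibleModPGaloisRep_smul_iff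
        ((V.quadraticTwist (((-1 : ℚ) ^ (p / 2)) * p)).quadraticTwist (((-1 : ℚ) ^ (p / 2)) * p)) C p
      rw [hC] at h1
      exact ((V.quadraticTwist (((-1 : ℚ) ^ (p / 2)) * p)).hasIrreducibleModPGaloisRep_quadraticTwist_iff
        hc p).mp (h1.mp hirrV)
    have h3W :=
      Kato2004.exists_coker_free_of_smul_eq_quadraticTwist_primeStar_of_forall_hasSurjectiveModNGaloisRep
        hp2 C hC hsurj
    rw [hspan]
    exact lengthAt_etaSigned_le_of_zeta_of_thm13_4Contra_of_irreducible E h134c hp2 hgood hf hϖ hκ hγ hv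
      hirrW h3W D 𝔭 h𝔭 hfix

/-- **The ι-SAFE slice of crux 20445 BY NAME from `{hZ, Q73′, h12}` — no `ι`-symmetry, no functional equation.**
For every tower-onto row (`V/ℚ` globally minimal, `p ≥ 5` good, `a_p = 0`, `ρ̄_{V,p^m}` onto for all `m`) and every
set of binders of `QuadraticBranchPlusKatoDivisibilityAt V p` (admissible quadratic model `(F, V', κF, γF)`, newform,
period ratio, `L_p⁺(V,η,X)`, dual data `D` of `Sel⁺(V/ℚ_∞)` and `DF` of `Sel⁺(V'/F_∞)`): `X⁺(V'/F_∞)` is finitely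
generated `Λ`-torsion, and at every height-one prime `𝔭` FIXED by the Iwasawa involution
(`PrimeSpectrum.comap (IwasawaAlgebra.invol p) 𝔭 = 𝔭`; e.g. `(T)`, `(p)`, `(Φ_{pⁿ}(1+T))`)
`ℓ_𝔭(X⁺(V'/F_∞)) ≤ ℓ_𝔭(X⁺(V/ℚ_∞)) + ℓ_𝔭(Λ/(L_p⁺(V,η,X)))` — the prime-by-prime form of (RK⁺)
`Char X⁺(V/F_∞) ⊇ Char X⁺(V/ℚ_∞)·(L_p⁺)` at those primes. At a general `𝔭` the same chain from Q73′ gives the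
inequality with `ℓ_{ι𝔭}` on the `L`-side only after an `ι`-symmetry (§2) — not claimed. Same frame as
`KatoSideOnto.plusKatoDivisibilityBranchOnto_of_zeta_of_thm13_4_of_thm12` (decomposition
`X⁺(V'/F_∞) ≃ X⁺(V/ℚ_∞) × X⁺(V/K_∞)^η` over the proved descent frame, Thm. 1.2 for `X⁺(V/ℚ_∞)`).
[cite: Kobayashi2003, Thm. 4.1 (p. 8), Thm. 2.2 (p. 5), Thm. 1.2 (p. 2), last sentence of §7 (p. 13)]
[cite: Kato2004Asterisque, Thm. 13.4 (p. 226), (12.5.2) (p. 222)] [cite: GreenbergLNM1716, §3 (descent; reading)] -/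
theorem plusKatoDivisibilityBranchOntoFixedPrimes_of_zeta_of_thm13_4Contra_of_thm12
    (hZ : Kobayashi2003.thm62_63_73_etaColemanPoitouTate_zeta)
    (h134c : Kato2004.thm13_4_lengthAt_fineSelmerDualContra_le_of_isEulerSystemClass)
    (h12 : Kobayashi2003.thm12_signedSelmerDual_finite_torsion)
    (V : WeierstrassCurve ℚ) [V.IsElliptic] [V.IsGloballyMinimal] (hp5 : 5 ≤ p)
    (hgood : V.HasGoodReductionAtPrime p) (hap : V.frobeniusTrace p = 0)
    (hsurj : ∀ m : ℕ, V.HasSurjectiveModNGaloisRep (p ^ m : ℕ))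
    (F : Type) [Field F] [NumberField F] (V' : WeierstrassCurve F) [V'.IsElliptic]
    {κ : ZpExtension ℚ p} {γ : absoluteGaloisGroup ℚ} {κF : ZpExtension F p} {γF : absoluteGaloisGroup F}
    {N : ℕ} [NeZero N] {f : CuspForm (Gamma0 N) 2}
    (hF : Module.finrank ℚ F = 2) (hθ : ∃ θ : F, θ ^ 2 = algebraMap ℚ F ((-1) ^ (p / 2) * p))
    (hC : ∃ C : VariableChange F, C • V.baseChange F = V')
    (hκ : κ.IsCyclotomic) (hγ : κ.IsTopGenerator γ) (hγc : IsCyclotomicVariable p γ)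
    (hκF : κF.IsCyclotomic) (hγF : κF.IsTopGenerator γF)
    (hζ : ∃ ζ : ℤ_[p]ˣ, IsOfFinOrder ζ ∧
      ((GaloisRep.cyclotomicCharacter F p γF * ζ : ℤ_[p]ˣ) : ℤ_[p]) = (cyclotomicGenerator p : ℤ_[p]))
    (hf : IsNewformOf V f)
    (ϖ : ℚ) (hϖ : if Even (p / 2) then (ϖ : ℝ) * V.realPeriodRat = plusPeriod f
      else (ϖ : ℝ) * V.imaginaryPeriodRat = minusPeriod f)
    (Lη : IwasawaAlgebra p) (hL : IsQuadraticBranchPlusLFunction f p ϖ Lη)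
    (D : Kobayashi2003.SignedSelmerDualData V κ γ 1) (DF : Kobayashi2003.SignedSelmerDualData V' κF γF 1) :
    Module.Finite (IwasawaAlgebra p) DF.X ∧ Module.IsTorsion (IwasawaAlgebra p) DF.X ∧
      ∀ 𝔭 : PrimeSpectrum (IwasawaAlgebra p), 𝔭.asIdeal.height = 1 →
        PrimeSpectrum.comap (IwasawaAlgebra.invol p).toRingHom 𝔭 = 𝔭 →
          lengthAt (IwasawaAlgebra p) DF.X 𝔭 ≤
            lengthAt (IwasawaAlgebra p) D.X 𝔭 +
              lengthAt (IwasawaAlgebra p) (IwasawaAlgebra p ⧸ Ideal.span {Lη}) 𝔭 := by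
  have hp2 : p ≠ 2 := by omega
  have hc : (((-1 : ℚ) ^ (p / 2)) * p) ≠ 0 :=
    mul_ne_zero (pow_ne_zero _ (by norm_num)) (Nat.cast_ne_zero.mpr (Fact.out : p.Prime).ne_zero)
  have hv : ∀ [(V.quadraticTwist (((-1 : ℚ) ^ (p / 2)) * p)).IsElliptic],
      ∃ σ : absoluteGaloisGroup ℚ,
        (∀ (n : ℕ) (t : AlgebraicClosure ℚ), t ^ p ^ n = 1 → σ • t = t) ∧
          Module.finrank ℤ_[p]
            (((V.quadraticTwist (((-1 : ℚ) ^ (p / 2)) * p)).tateModule p) ⧸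
              LinearMap.range
                ((V.quadraticTwist (((-1 : ℚ) ^ (p / 2)) * p)).galoisRepTate p σ - 1)) = 1 := by
    intro _
    obtain ⟨C, hC⟩ := exists_variableChange_twist_twist V hc
    exact Kato2004.exists_finrank_coker_eq_one_of_smul_eq_quadraticTwist_primeStar_of_forall_hasSurjectiveModNGaloisRep
      hp2 C hC hsurj
  haveI : NeZero p := ⟨(Fact.out : p.Prime).ne_zero⟩
  haveI : IsCyclotomicExtension {p} ℚ (CyclotomicField p ℚ) :=
    CyclotomicField.isCyclotomicExtension p ℚ
  haveI : (galRange (K := ℚ) (CyclotomicField p ℚ)).Normal := normal_galRange_cyclotomic p _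
  obtain ⟨θ, ηq, -, -, -, hηK, hη1⟩ := exists_theta_eta_cyclotomicField p hp2
  obtain ⟨γ', hγ'K, hγ', hγ'c, Dη, ⟨e⟩⟩ :=
    exists_etaDatum_prod_linearEquiv_of_decomposition (CyclotomicField p ℚ) ηq
      (fun κ₁ γ₁ hκ₁ hγ₁ hγ₁K hγ₁c F₁ _ _ V₁ _ κF₁ γF₁ hF₁ hθ₁ hC₁ hκF₁ hγF₁ hζ₁ =>
        etaDescentFrame_proof p hp5 (CyclotomicField p ℚ) ηq hηK hη1 V hgood hap κ₁ γ₁ hκ₁ hγ₁ hγ₁K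
          hγ₁c F₁ V₁ κF₁ γF₁ hF₁ hθ₁ hC₁ hκF₁ hγF₁ hζ₁)
      F V' hF hθ hC hκ hγ hγc hκF hγF hζ D DF
  obtain ⟨hDfin, hDtor⟩ := h12 V p hp2 hgood hap κ γ hκ hγ 1 D
  -- the Literature promotion copy of the `η`-object (same carrier and `Λ`-structure)
  let Dη' : Kobayashi2003.EtaSignedSelmerDualData V κ (CyclotomicField p ℚ) ℚ_[p] ηq γ' 1 :=
    { X := Dη.X
      conj_mem := Dη.conj_mem
      toDual := Dη.toDual
      bijective := Dη.bijective
      toDual_T_smul := Dη.toDual_T_smul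
      toDual_C_smul := Dη.toDual_C_smul }
  obtain ⟨hηfin, hηtor, -, hfix⟩ :=
    etaKatoFixedPrimes_of_zeta_of_thm13_4Contra hZ h134c (CyclotomicField p ℚ) ηq hηK hη1 V hv hp2 hgood
      hap hf ϖ hϖ Lη hL κ γ' hκ hγ' hγ'K hγ'c Dη'
  haveI : Module.Finite (IwasawaAlgebra p) D.X := hDfin
  haveI : Module.Finite (IwasawaAlgebra p) Dη.X := hηfin
  have hPtor : Module.IsTorsion (IwasawaAlgebra p) (D.X × Dη.X) :=
    isTorsion_prod_of_isTorsion hDtor hηtor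
  have htorF : Module.IsTorsion (IwasawaAlgebra p) DF.X := by
    intro x
    obtain ⟨a, ha⟩ := @hPtor (e x)
    refine ⟨a, ?_⟩
    rw [Submonoid.smul_def] at ha ⊢
    have h := congrArg e.symm ha
    rwa [map_smul, map_zero, LinearEquiv.symm_apply_apply] at h
  refine ⟨Module.Finite.equiv e.symm, htorF, fun 𝔭 h𝔭 h𝔭fix ↦ ?_⟩
  rw [lengthAt_eq_of_linearEquiv e 𝔭, lengthAt_prod]
  exact add_le_add le_rfl (hfix hsurj 𝔭 h𝔭 h𝔭fix)

end RK

end KatoSideContra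

end Summit.BirchSwinnertonDyer.BirchSwinnertonDyer.Theorems

end
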